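import Summits.HubbardSuperconductivity.HubbardSuperconductivity.Theorems.AnisotropyChordTowerSectorFun
import Summits.HubbardSuperconductivity.HubbardSuperconductivity.Theorems.AnisotropyChordTowerDeficit
import Summits.HubbardSuperconductivity.HubbardSuperconductivity.Theorems.AnisotropyChordTwoMagnonCoordinates
import Summits.HubbardSuperconductivity.HubbardSuperconductivity.Theorems.AnisotropyChordStiffnessZeroMode
import Literature.MathematicalPhysics.QuantumLattice.GroundStateSectorGapModeBound

/-!
# Route `AnisotropyChord` / H0 rotor rung: THE BRIDGE (α) — the tree's XXZ Hamiltonian on real amplitudes is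
# `A + (1−Δ)·W + e₀`, and a Perron sector ground amplitude is a Rayleigh–Ritz minimiser of that form on its sector
# (work-order v13(d) of theory seat `hubbard-h0-rotor-theory-1`, memo ROTOR-THEORY-11 §160 (α), §161 (d); director
# CYCLE-12 ruling (A))

For `H(Δ) = xxzHamiltonian 1 G (−1) Δ` on any finite simple graph and a REAL amplitude `a`:

* `xxz_mulVec_real_apply` : `(H(Δ) a)(σ) = (A a)(σ) + (1 − Δ)·W(σ)·a(σ) − (D/8)·a(σ)` with `A = fmOp G` (the transposition
  form `½ Σ_E (1 − T_xy)`), `W = isingW G` (the Ising bond sum) and `D = Σ_x Σ_y [x ∼ y]` the ordered edge count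
  (`e₀ = −|E|/4`), from the hopping formula `OneMagnon.xxz_mulVec_apply`;
* `star_dotProduct_xxz_real` : `⟨a, H(Δ) a⟩ = Σ_σ a(σ)((A a)(σ) + (1−Δ) W(σ) a(σ)) − (D/8) Σ_σ a(σ)²`.

On the torus `(ℤ/L)²`, for `IsPerronSectorGroundAmplitude L Δ M a`:
* `perron_support` : `a(σ) ≠ 0 ⇒ zerosCard σ = L²/2 + M`;
* `perron_eigen_real` : `A a + (1−Δ) W a = (E(M) + D/8)·a` pointwise (`E(M) = lowestEnergyInSector`);
* `rayleigh_real` : for every real `b` supported on the sector, `(E(M) + D/8)·Σ b² ≤ Σ_σ b((A b) + (1−Δ) W b)`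
  (Literature `minEnergyOn_mul_le_rayleigh_of_mem`), and `perron_rayleigh` : the homogeneous Rayleigh–Ritz
  minimality of `a` that `Tower.bootstrap` consumes;
* `perron_eq` : two Perron amplitudes of one sector coincide (tree `Stiffness.sectorGround_eq_smul_perron`).
-/

set_option linter.dupNamespace false
set_option autoImplicit false

noncomputable section

open Finset Matrix Complex
open scoped ComplexConjugate
open Summit.HubbardSuperconductivity.HubbardSuperconductivity.Theorems.AnisotropyChord.InsertionEntropy
open Literature.MathematicalPhysics.QuantumLattice Literature.Probability.LatticeModels

namespace Summit.HubbardSuperconductivity.HubbardSuperconductivity.Theorems.AnisotropyChord.Tower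

section General

variable {V : Type} [Fintype V] [DecidableEq V]

/-- Every element of `Fin 2` is `0` or `1`. [folklore] -/
private theorem fin2_cases'' (i : Fin 2) : i = 0 ∨ i = 1 := by
  rcases i with ⟨_ | _ | k, hk⟩
  · left; rfl
  · right; rfl
  · omega

omit [DecidableEq V] in
/-- pull a constant into a double sum. [folklore] -/
private theorem smul_sum₂' (c : ℝ) (F : V → V → ℝ) : c * ∑ x, ∑ y, F x y = ∑ x, ∑ y, c * F x y := by
  rw [Finset.mul_sum]; refine Finset.sum_congr rfl fun x _ => ?_; rw [Finset.mul_sum]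

omit [DecidableEq V] in
/-- add two double sums. [folklore] -/
private theorem sum₂_add' (F F' : V → V → ℝ) :
    (∑ x, ∑ y, F x y) + (∑ x, ∑ y, F' x y) = ∑ x, ∑ y, (F x y + F' x y) := by
  rw [← Finset.sum_add_distrib]; refine Finset.sum_congr rfl fun x _ => ?_; rw [← Finset.sum_add_distrib]

omit [DecidableEq V] in
/-- subtract two double sums. [folklore] -/
private theorem sum₂_sub' (F F' : V → V → ℝ) :
    (∑ x, ∑ y, F x y) - (∑ x, ∑ y, F' x y) = ∑ x, ∑ y, (F x y - F' x y) := by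
  rw [← Finset.sum_sub_distrib]; refine Finset.sum_congr rfl fun x _ => ?_; rw [← Finset.sum_sub_distrib]

variable (G : SimpleGraph V) [DecidableRel G.Adj]

omit [Fintype V] [DecidableEq V] in
/-- The Ising factor of a bond on a `0/1` configuration: `(½ − σ_x)(½ − σ_y) = ±¼`. [folklore] -/
theorem ising_factor_eq (σ : V → Fin 2) (x y : V) :
    ((1 : ℝ) / 2 - (σ x : ℕ)) * ((1 : ℝ) / 2 - (σ y : ℕ)) = if σ x = σ y then (1/4 : ℝ) else -(1/4 : ℝ) := by
  rcases fin2_cases'' (σ x) with hx | hx <;> rcases fin2_cases'' (σ y) with hy | hy <;>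
    simp [hx, hy] <;> norm_num

/-- **THE BRIDGE (α), pointwise.**  On a real amplitude `a`, the tree's spin-½ XXZ Hamiltonian
`H(Δ) = xxzHamiltonian 1 G (−1) Δ` acts as `A + (1 − Δ)·W − D/8`:
`(H(Δ) a)(σ) = fmOp G a σ + (1 − Δ)·isingW G σ·a σ − (D/8)·a σ`, `D = Σ_x Σ_y [x ∼ y] = 2|E|`. [folklore] -/
theorem xxz_mulVec_real_apply (Δ : ℝ) (a : (V → Fin 2) → ℝ) (σ : V → Fin 2) :
    ((xxzHamiltonian 1 G (-1) Δ : Op V 2) *ᵥ (fun τ => (a τ : ℂ))) σ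
      = ((fmOp G a σ + (1 - Δ) * (isingW G σ * a σ)
          - (1/8 : ℝ) * (∑ x, ∑ y, if G.Adj x y then (1:ℝ) else 0) * a σ : ℝ) : ℂ) := by
  rw [OneMagnon.xxz_mulVec_apply, TwoMagnon.sum_edgeFinset_lift_eq_half, TwoMagnon.sum_edgeFinset_lift_eq_half]
  -- the complex hop sum is the cast of a real sum
  have hhop : (∑ x, ∑ y, (if G.Adj x y then
        (if σ x ≠ σ y then ((a (σ ∘ ⇑(Equiv.swap x y)) : ℝ) : ℂ) else 0) else 0))
      = ((∑ x, ∑ y, (if G.Adj x y then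
          (if σ x ≠ σ y then a (σ ∘ ⇑(Equiv.swap x y)) else 0) else 0) : ℝ) : ℂ) := by
    push_cast
    refine Finset.sum_congr rfl fun x _ => Finset.sum_congr rfl fun y _ => ?_
    split_ifs <;> simp
  rw [hhop]
  -- the real identity, bond by bond
  have key : -(Δ * ((1/2 : ℝ) * ∑ x, ∑ y, if G.Adj x y then ((1 : ℝ) / 2 - (σ x : ℕ)) * ((1 : ℝ) / 2 - (σ y : ℕ)) else 0))
        * a σ - (1/2 : ℝ) * ((1/2 : ℝ) * ∑ x, ∑ y, (if G.Adj x y then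
          (if σ x ≠ σ y then a (σ ∘ ⇑(Equiv.swap x y)) else 0) else 0))
      = fmOp G a σ + (1 - Δ) * (isingW G σ * a σ)
          - (1/8 : ℝ) * (∑ x, ∑ y, if G.Adj x y then (1:ℝ) else 0) * a σ := by
    unfold fmOp isingW
    have hL : -(Δ * ((1/2 : ℝ) * ∑ x, ∑ y, if G.Adj x y then ((1 : ℝ) / 2 - (σ x : ℕ)) * ((1 : ℝ) / 2 - (σ y : ℕ)) else 0))
        * a σ - (1/2 : ℝ) * ((1/2 : ℝ) * ∑ x, ∑ y, (if G.Adj x y then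
          (if σ x ≠ σ y then a (σ ∘ ⇑(Equiv.swap x y)) else 0) else 0))
        = ∑ x, ∑ y, (-(Δ / 2 * a σ) * (if G.Adj x y then ((1 : ℝ) / 2 - (σ x : ℕ)) * ((1 : ℝ) / 2 - (σ y : ℕ)) else 0)
            - (1/4 : ℝ) * (if G.Adj x y then (if σ x ≠ σ y then a (σ ∘ ⇑(Equiv.swap x y)) else 0) else 0)) := by
      rw [← sum₂_sub', ← smul_sum₂', ← smul_sum₂']; ring
    have hR : (1/4 : ℝ) * (∑ x, ∑ y, if G.Adj x y then (a σ - a (σ ∘ ⇑(Equiv.swap x y))) else 0)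
          + (1 - Δ) * ((1/2 : ℝ) * (∑ x, ∑ y, if G.Adj x y then (if σ x = σ y then (1/4 : ℝ) else -(1/4 : ℝ)) else 0) * a σ)
          - (1/8 : ℝ) * (∑ x, ∑ y, if G.Adj x y then (1:ℝ) else 0) * a σ
        = ∑ x, ∑ y, ((1/4 : ℝ) * (if G.Adj x y then (a σ - a (σ ∘ ⇑(Equiv.swap x y))) else 0)
            + ((1 - Δ) / 2 * a σ) * (if G.Adj x y then (if σ x = σ y then (1/4 : ℝ) else -(1/4 : ℝ)) else 0)
            - (a σ / 8) * (if G.Adj x y then (1:ℝ) else 0)) := by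
      rw [← sum₂_sub', ← sum₂_add', ← smul_sum₂', ← smul_sum₂', ← smul_sum₂']; ring
    rw [hL, hR]
    refine Finset.sum_congr rfl fun x _ => Finset.sum_congr rfl fun y _ => ?_
    by_cases hadj : G.Adj x y
    · simp only [hadj, if_true, ising_factor_eq]
      by_cases hxy : σ x = σ y
      · rw [comp_swap_of_eq σ hxy]; simp [hxy]; ring
      · simp [hxy]; ring
    · simp [hadj]
  have key' := congrArg (fun r : ℝ => (r : ℂ)) key
  push_cast at key' ⊢
  simpa using key'

/-- `⟨a, a⟩ = Σ a²` for a real amplitude read in `ℂ`. [folklore] -/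
theorem star_dotProduct_real (a : (V → Fin 2) → ℝ) :
    star (fun τ => (a τ : ℂ)) ⬝ᵥ (fun τ => (a τ : ℂ)) = (((∑ σ, a σ ^ 2 : ℝ)) : ℂ) := by
  unfold dotProduct
  push_cast
  refine Finset.sum_congr rfl fun σ _ => ?_
  simp [Pi.star_apply, Complex.conj_ofReal, sq]

/-- **THE BRIDGE (α), quadratic form:** `⟨a, H(Δ) a⟩ = Σ_σ a σ·(fmOp G a σ + (1−Δ) isingW σ a σ) − (D/8) Σ_σ a σ²`
for a real amplitude `a`. [folklore] -/
theorem star_dotProduct_xxz_real (Δ : ℝ) (a : (V → Fin 2) → ℝ) :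
    star (fun τ => (a τ : ℂ)) ⬝ᵥ ((xxzHamiltonian 1 G (-1) Δ : Op V 2) *ᵥ (fun τ => (a τ : ℂ)))
      = (((∑ σ, a σ * (fmOp G a σ + (1 - Δ) * (isingW G σ * a σ))
          - (1/8 : ℝ) * (∑ x, ∑ y, if G.Adj x y then (1:ℝ) else 0) * ∑ σ, a σ ^ 2 : ℝ)) : ℂ) := by
  set c : ℝ := (1/8 : ℝ) * (∑ x, ∑ y, if G.Adj x y then (1:ℝ) else 0) with hc
  have hR : (∑ σ, a σ * (fmOp G a σ + (1 - Δ) * (isingW G σ * a σ))) - c * ∑ σ, a σ ^ 2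
      = ∑ σ, a σ * (fmOp G a σ + (1 - Δ) * (isingW G σ * a σ) - c * a σ) := by
    rw [Finset.mul_sum, ← Finset.sum_sub_distrib]
    refine Finset.sum_congr rfl fun σ _ => ?_; ring
  rw [hR]
  unfold dotProduct
  push_cast
  refine Finset.sum_congr rfl fun σ _ => ?_
  rw [xxz_mulVec_real_apply, ← hc]
  simp only [Pi.star_apply, Complex.star_def, Complex.conj_ofReal]
  push_cast
  ring

omit [DecidableEq V] in
/-- `|isingW σ| ≤ D/8`. [folklore] -/
theorem abs_isingW_le (σ : V → Fin 2) :
    |isingW G σ| ≤ (1/8 : ℝ) * ∑ x, ∑ y, if G.Adj x y then (1:ℝ) else 0 := by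
  unfold isingW
  rw [abs_mul, abs_of_pos (by norm_num : (0:ℝ) < 1/2), smul_sum₂' (1/8 : ℝ),
    show (1/2 : ℝ) * |∑ x, ∑ y, if G.Adj x y then (if σ x = σ y then (1/4 : ℝ) else -(1/4 : ℝ)) else 0|
      = |∑ x, ∑ y, (1/2 : ℝ) * (if G.Adj x y then (if σ x = σ y then (1/4 : ℝ) else -(1/4 : ℝ)) else 0)| by
      rw [← smul_sum₂', abs_mul, abs_of_pos (by norm_num : (0:ℝ) < 1/2)]]
  refine le_trans (Finset.abs_sum_le_sum_abs _ _) (Finset.sum_le_sum fun x _ => ?_)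
  refine le_trans (Finset.abs_sum_le_sum_abs _ _) (Finset.sum_le_sum fun y _ => ?_)
  by_cases hadj : G.Adj x y
  · by_cases hxy : σ x = σ y
    · simp [hadj, hxy]; norm_num
    · simp [hadj, hxy]; norm_num
  · simp [hadj]

/-- `|Σ_σ isingW σ · b σ²| ≤ (D/8) Σ b²` — the bound `|⟨b, W b⟩| ≤ w_max ‖b‖²` of the perturbation. [folklore] -/
theorem abs_inner_isingW_le (b : (V → Fin 2) → ℝ) :
    |∑ σ, isingW G σ * b σ ^ 2| ≤ ((1/8 : ℝ) * ∑ x, ∑ y, if G.Adj x y then (1:ℝ) else 0) * ∑ σ, b σ ^ 2 := by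
  rw [Finset.mul_sum]
  refine le_trans (Finset.abs_sum_le_sum_abs _ _) (Finset.sum_le_sum fun σ _ => ?_)
  rw [abs_mul, abs_of_nonneg (sq_nonneg (b σ))]
  exact mul_le_mul_of_nonneg_right (abs_isingW_le G σ) (sq_nonneg _)

end General

/-! ## On the torus: Perron sector ground amplitudes as Rayleigh–Ritz minimisers of `A + (1−Δ)W` -/

section Torus

variable {L : ℕ} [NeZero L]

/-- **Support of a Perron sector amplitude:** `a σ ≠ 0 ⇒ zerosCard σ = |V|/2 + M` (the sector `Sᶻ_tot = M` is
spanned by the configurations with `|V|/2 + M` up spins). [folklore] -/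
theorem perron_support {Δ M : ℝ} {a : TensorIndex (TorusSite 2 L) 2 → ℝ}
    (ha : IsPerronSectorGroundAmplitude L Δ M a) (σ : TensorIndex (TorusSite 2 L) 2) (hσ : a σ ≠ 0) :
    zerosCard σ = (Fintype.card (TorusSite 2 L) : ℝ) / 2 + M := by
  have h := (LiebMattis.mem_spinZSector_iff (Λ := TorusSite 2 L) 1 M (fun τ => (a τ : ℂ))).1 ha.sector σ
    (by simpa using hσ)
  -- `Σ_x (1/2 − σ_x) = M` in `ℂ`; read it in `ℝ`
  have hre : (∑ x : TorusSite 2 L, ((1 : ℝ) / 2 - (σ x : ℕ))) = M := by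
    have h' : (((∑ x : TorusSite 2 L, ((1 : ℝ) / 2 - (σ x : ℕ)) : ℝ)) : ℂ) = (M : ℂ) := by
      push_cast at h ⊢; exact h
    exact_mod_cast h'
  have hsplit : (∑ x : TorusSite 2 L, ((1 : ℝ) / 2 - (σ x : ℕ)))
      = (Fintype.card (TorusSite 2 L) : ℝ) / 2 - ∑ x : TorusSite 2 L, ((σ x : ℕ) : ℝ) := by
    rw [Finset.sum_sub_distrib, Finset.sum_const, Finset.card_univ, nsmul_eq_mul]; ring
  have hones : (∑ x : TorusSite 2 L, ((σ x : ℕ) : ℝ)) = (Fintype.card (TorusSite 2 L) : ℝ) - zerosCard σ := by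
    have h1 : ∀ x : TorusSite 2 L, ((σ x : ℕ) : ℝ) = 1 - (if σ x = 0 then (1:ℝ) else 0) := by
      intro x; rcases fin2_cases'' (σ x) with hx | hx <;> simp [hx]
    simp_rw [h1]
    rw [Finset.sum_sub_distrib, Finset.sum_const, Finset.card_univ, nsmul_eq_mul, mul_one]
    unfold zerosCard; rw [← Finset.sum_filter]; simp
  rw [hsplit, hones] at hre
  linarith

/-- **Eigen-equation of a Perron sector amplitude in amplitude form:**
`fmOp a + (1−Δ)·isingW·a = (E(M) + D/8)·a` pointwise, `E(M) = lowestEnergyInSector H(Δ) M`. [folklore] -/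
theorem perron_eigen_real {Δ M : ℝ} {a : TensorIndex (TorusSite 2 L) 2 → ℝ}
    (ha : IsPerronSectorGroundAmplitude L Δ M a) (σ : TensorIndex (TorusSite 2 L) 2) :
    fmOp (torusGraph 2 L) a σ + (1 - Δ) * (isingW (torusGraph 2 L) σ * a σ)
      = (lowestEnergyInSector 1 (xxzHamiltonian 1 (torusGraph 2 L) (-1) Δ) M
          + (1/8 : ℝ) * ∑ x, ∑ y, if (torusGraph 2 L).Adj x y then (1:ℝ) else 0) * a σ := by
  have h := congrFun ha.eigen σ
  rw [xxz_mulVec_real_apply, Pi.smul_apply, smul_eq_mul] at h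
  have h' : (fmOp (torusGraph 2 L) a σ + (1 - Δ) * (isingW (torusGraph 2 L) σ * a σ)
      - (1/8 : ℝ) * (∑ x, ∑ y, if (torusGraph 2 L).Adj x y then (1:ℝ) else 0) * a σ : ℝ)
      = lowestEnergyInSector 1 (xxzHamiltonian 1 (torusGraph 2 L) (-1) Δ) M * a σ := by
    exact_mod_cast h
  linarith

/-- The amplitude-level energy of a Perron sector amplitude: `Σ a(Aa + (1−Δ)Wa) = E(M) + D/8`. [folklore] -/
theorem perron_energy_real {Δ M : ℝ} {a : TensorIndex (TorusSite 2 L) 2 → ℝ}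
    (ha : IsPerronSectorGroundAmplitude L Δ M a) :
    ∑ σ, a σ * (fmOp (torusGraph 2 L) a σ + (1 - Δ) * (isingW (torusGraph 2 L) σ * a σ))
      = lowestEnergyInSector 1 (xxzHamiltonian 1 (torusGraph 2 L) (-1) Δ) M
          + (1/8 : ℝ) * ∑ x, ∑ y, if (torusGraph 2 L).Adj x y then (1:ℝ) else 0 := by
  set e : ℝ := lowestEnergyInSector 1 (xxzHamiltonian 1 (torusGraph 2 L) (-1) Δ) M
          + (1/8 : ℝ) * ∑ x, ∑ y, if (torusGraph 2 L).Adj x y then (1:ℝ) else 0 with he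
  calc (∑ σ, a σ * (fmOp (torusGraph 2 L) a σ + (1 - Δ) * (isingW (torusGraph 2 L) σ * a σ)))
      = ∑ σ, e * a σ ^ 2 := Finset.sum_congr rfl fun σ _ => by rw [perron_eigen_real ha σ, ← he]; ring
    _ = e * ∑ σ, a σ ^ 2 := by rw [Finset.mul_sum]
    _ = e := by rw [ha.unit, mul_one]

/-- **Rayleigh–Ritz on a sector, amplitude form:** for a real `b` supported on the configurations of the sector
`Sᶻ_tot = M`, `(E(M) + D/8)·Σ b² ≤ Σ_σ b σ (fmOp b σ + (1−Δ) isingW σ b σ)`. [folklore] -/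
theorem rayleigh_real (Δ M : ℝ) (b : TensorIndex (TorusSite 2 L) 2 → ℝ)
    (hb : ∀ σ, b σ ≠ 0 → zerosCard σ = (Fintype.card (TorusSite 2 L) : ℝ) / 2 + M) :
    (lowestEnergyInSector 1 (xxzHamiltonian 1 (torusGraph 2 L) (-1) Δ) M
        + (1/8 : ℝ) * ∑ x, ∑ y, if (torusGraph 2 L).Adj x y then (1:ℝ) else 0) * ∑ σ, b σ ^ 2
      ≤ ∑ σ, b σ * (fmOp (torusGraph 2 L) b σ + (1 - Δ) * (isingW (torusGraph 2 L) σ * b σ)) := by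
  -- `b` (read in `ℂ`) lies in the sector
  have hmem : (fun τ => (b τ : ℂ)) ∈ spinZSector (Λ := TorusSite 2 L) 1 M := by
    refine (LiebMattis.mem_spinZSector_iff (Λ := TorusSite 2 L) 1 M _).2 fun σ hσ => ?_
    have hσ' : b σ ≠ 0 := by simpa using hσ
    have hz := hb σ hσ'
    have hones : (∑ x : TorusSite 2 L, ((σ x : ℕ) : ℝ)) = (Fintype.card (TorusSite 2 L) : ℝ) - zerosCard σ := by
      have h1 : ∀ x : TorusSite 2 L, ((σ x : ℕ) : ℝ) = 1 - (if σ x = 0 then (1:ℝ) else 0) := by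
        intro x; rcases fin2_cases'' (σ x) with hx | hx <;> simp [hx]
      simp_rw [h1]
      rw [Finset.sum_sub_distrib, Finset.sum_const, Finset.card_univ, nsmul_eq_mul, mul_one]
      unfold zerosCard; rw [← Finset.sum_filter]; simp
    have hre : (∑ x : TorusSite 2 L, ((1 : ℝ) / 2 - (σ x : ℕ))) = M := by
      rw [Finset.sum_sub_distrib, Finset.sum_const, Finset.card_univ, nsmul_eq_mul, hones, hz]; ring
    have := congrArg (fun r : ℝ => (r : ℂ)) hre
    push_cast at this ⊢
    exact this
  have h := minEnergyOn_mul_le_rayleigh_of_mem (xxzHamiltonian_isHermitian 1 (torusGraph 2 L) (-1) Δ)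
    (spinZSector (Λ := TorusSite 2 L) 1 M) hmem
  rw [star_dotProduct_real, star_dotProduct_xxz_real, Complex.ofReal_re, Complex.ofReal_re] at h
  unfold lowestEnergyInSector
  linarith

/-- **Rayleigh–Ritz minimality of a Perron sector amplitude, homogeneous form** (the hypothesis `hmin` of
`Tower.bootstrap`): `q(a)·Σ b² ≤ q(b)` for every real `b` supported on the sector, `q(b) = Σ b(Ab + (1−Δ)Wb)`. [folklore] -/
theorem perron_rayleigh {Δ M : ℝ} {a : TensorIndex (TorusSite 2 L) 2 → ℝ}
    (ha : IsPerronSectorGroundAmplitude L Δ M a) (b : TensorIndex (TorusSite 2 L) 2 → ℝ)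
    (hb : ∀ σ, b σ ≠ 0 → zerosCard σ = (Fintype.card (TorusSite 2 L) : ℝ) / 2 + M) :
    (∑ σ, a σ * (fmOp (torusGraph 2 L) a σ + (1 - Δ) * (isingW (torusGraph 2 L) σ * a σ))) * ∑ σ, b σ ^ 2
      ≤ ∑ σ, b σ * (fmOp (torusGraph 2 L) b σ + (1 - Δ) * (isingW (torusGraph 2 L) σ * b σ)) := by
  rw [perron_energy_real ha]
  exact rayleigh_real Δ M b hb

/-- **Uniqueness of the Perron sector amplitude** (Perron–Frobenius on the connected sector graph, tree
`Stiffness.sectorGround_eq_smul_perron`): two Perron amplitudes of one sector of `H(Δ)` coincide. [folklore] -/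
theorem perron_eq {Δ M : ℝ} {a a' : TensorIndex (TorusSite 2 L) 2 → ℝ}
    (ha : IsPerronSectorGroundAmplitude L Δ M a) (ha' : IsPerronSectorGroundAmplitude L Δ M a') : a = a' := by
  obtain ⟨c, hc⟩ := Stiffness.sectorGround_eq_smul_perron L Δ M a ha ha'.sector ha'.eigen
  -- `a' = c • a` with both unit and non-negative forces `c = 1`
  have hc' : ∀ σ, (a' σ : ℂ) = c * (a σ : ℂ) := fun σ => by
    have := congrFun hc σ; simpa [Stiffness.toC] using this
  have hre : ∀ σ, a' σ = c.re * a σ := fun σ => by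
    have := congrArg Complex.re (hc' σ); simpa using this
  have hsq : c.re ^ 2 = 1 := by
    have h1 := ha'.unit
    simp_rw [hre] at h1
    rw [show (∑ σ, (c.re * a σ) ^ 2) = c.re ^ 2 * ∑ σ, a σ ^ 2 by
      rw [Finset.mul_sum]; refine Finset.sum_congr rfl fun σ _ => ?_; ring, ha.unit, mul_one] at h1
    exact h1
  -- some `a σ > 0` (unit, non-negative) fixes the sign of `c.re`
  obtain ⟨σ₀, hσ₀⟩ : ∃ σ₀, a σ₀ ≠ 0 := by
    by_contra h
    push Not at h
    have : ∑ σ, a σ ^ 2 = 0 := Finset.sum_eq_zero fun σ _ => by rw [h σ]; ring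
    rw [ha.unit] at this; exact one_ne_zero this
  have hpos : 0 < a σ₀ := lt_of_le_of_ne (ha.nonneg σ₀) (Ne.symm hσ₀)
  have hcre : 0 ≤ c.re := by
    have := ha'.nonneg σ₀; rw [hre σ₀] at this
    exact nonneg_of_mul_nonneg_left this hpos
  have hc1 : c.re = 1 := by nlinarith [hsq, hcre]
  funext σ; rw [hre σ, hc1, one_mul]

end Torus

end Summit.HubbardSuperconductivity.HubbardSuperconductivity.Theorems.AnisotropyChord.Tower
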